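import Summits.CriticalPhenomena.Ising3DConformalLimit.Theses.PlantedPinning

/-!
# Objects of the line `birth` (linear-benchmark split) for the crux `GaussianPinningSaturation`
(item stmt-CriticalPhenomena-8452; route decl
`Summit.CriticalPhenomena.Ising3DConformalLimit.Theses.PlantedPinning.GaussianPinningSaturation`)

Route-posited objects (D-0016: the definitions a line posits live in a reviewed `…Defs` file, never
inside a proof file; precedents `EnergyNotSigmaSquaredGapForcesFarMergingRPSchwarzDefs.lean`,
`EnergyNotSigmaSquaredGapForcesFarMergingSandwichDefs.lean`). The line (checked skeleton
`Cruxes/GaussianPinningSaturation/Lines/birth.lean`, registrar `planner-skel-stmt-CriticalPhenomena-8452-0`,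
lead seat `prover-line-stmt-CriticalPhenomena-8452-c1-0`) splits the planted conditional variance of the
total spin of the critical `+` box EXACTLY into a LINEAR (Schur-complement, value-blind) residual built
from the truncated two-point function only, minus the squared `L²`-norm of the NONLINEAR part of the
planted regression: `E⁺[Var(M_L | σ_P)] = R_L(P) − N_L(P)`, hence `e = e^{lin} − e^{gap}` for the
planted-pinning efficiency of the crux.

Contents (definitional bookkeeping only; the mathematics is in the stub files
`Theorems/PlantedPinningGaussianPinningSaturation*.lean` that import this module):
* the crux's `let`-tower as named objects: `plusE`, `totalSpin`, `plusProb`, `pinnedMean`, `pinnedVar`,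
  `plantedVar`, `effOf`, `plantedEff` (definitionally the crux's `eff`, see
  `gaussianPinningSaturation_iff`);
* the linear benchmark: `cov`, `covMat`, `covTot`, `linResidual`, `linPred`, `regressionGap`,
  `linVar`, `gapVar`, `linEff`, `gapEff`;
* the three currencies of the line (statements composed by the registered skeleton):
  `VarianceSplit` (stub A), `TwoPointSaturation` (stub B), `GaussianLinearisesRegression` (stub C);
* sanity lemmas: `plantedEff_eq_linEff_sub_gapEff` (A ⇒ `e = e^{lin} − e^{gap}`),
  `gaussianPinningSaturation_iff` (the crux unfolds to the `plantedEff` form, `Iff.rfl`) and the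
  composition certificate `gaussianPinningSaturation_of_split` (crux ⇐ A ∧ B ∧ C).
All objects are finite sums over existing `Literature.Probability.LatticeModels` declarations
(`isingExpect`, `isingWeight`, `isingPartitionFunction`, `glue`, `box`, `criticalBeta`, `spinAt`);
`d = 3`, `Λ_L = box 3 L`, `β = criticalBeta 3`, `h = 0`, `+` boundary condition throughout.

References: Montanari 2008 (arXiv:0709.0145) and Raghavendra–Tan 2012 (pinning lemma);
El Alaoui–Montanari 2021 eqs. (1.4)–(1.6); Friedli–Velenik 2017 Lemma 6.7 (finite-volume DLR).
-/

noncomputable section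

namespace Summit.CriticalPhenomena.Ising3DConformalLimit.PlantedPinningGaussianPinningSaturation

open scoped BigOperators Classical
open Finset MeasureTheory
open Literature.Probability.LatticeModels
open Summit.CriticalPhenomena.Ising3DConformalLimit.Theses.PlantedPinning

/-! ### The crux's `let`-tower as named objects -/

/-- The critical finite-volume `+` expectation `⟨f⟩⁺_{Λ_L;β_c(3),0}`.
(Route-posited notation of the line, not a literature fact.) -/
def plusE (L : ℕ) (f : SpinConfig (Site 3) → ℝ) : ℝ :=
  isingExpect (zdGraph 3) (box 3 L) (criticalBeta 3) 0 .plus f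

/-- Total spin of the box, `M_L(σ) = Σ_{x ∈ Λ_L} σ_x` (the crux's `M L`).
(Route-posited notation.) -/
def totalSpin (L : ℕ) (σ : SpinConfig (Site 3)) : ℝ :=
  ∑ x ∈ box 3 L, spinAt x σ

/-- Plus-state probability `w(τ)/Z` of the pattern `τ` on `Λ_L` (the planted law of the pin
values). (Route-posited notation.) -/
def plusProb (L : ℕ) (τ : ↥(box 3 L) → ℤˣ) : ℝ :=
  isingWeight (zdGraph 3) (box 3 L) (criticalBeta 3) 0 .plus τ /
    isingPartitionFunction (zdGraph 3) (box 3 L) (criticalBeta 3) 0 .plus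

/-- Conditional mean of `M_L` given the pins `P` at values `η`: the law given `σ_P = η_P` (and `+`
outside `Λ_L`) is `isingMeasure (zdGraph 3) (Λ_L ∖ P) β_c 0 (.fixed η)` (finite-volume DLR).
(Route-posited notation.) -/
def pinnedMean (L : ℕ) (P : Finset (Site 3)) (η : SpinConfig (Site 3)) : ℝ :=
  isingExpect (zdGraph 3) (box 3 L \ P) (criticalBeta 3) 0 (.fixed η) (totalSpin L)

/-- Conditional variance of `M_L` given the pins `P` at values `η` (the crux's `cvar L P η`).
(Route-posited notation.) -/
def pinnedVar (L : ℕ) (P : Finset (Site 3)) (η : SpinConfig (Site 3)) : ℝ :=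
  isingExpect (zdGraph 3) (box 3 L \ P) (criticalBeta 3) 0 (.fixed η) (fun σ => totalSpin L σ ^ 2)
    - isingExpect (zdGraph 3) (box 3 L \ P) (criticalBeta 3) 0 (.fixed η) (totalSpin L) ^ 2

/-- Planted conditional variance `v_{L,k}`: `pinnedVar` averaged over uniform `k`-subsets `P ⊆ Λ_L`
and over pin values `σ* ∼ μ⁺_{Λ_L}` (the crux's `pvar L k`). (Route-posited notation.) -/
def plantedVar (L k : ℕ) : ℝ :=
  (∑ P ∈ (box 3 L).powersetCard k, ∑ τ : ↥(box 3 L) → ℤˣ,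
      plusProb L τ * pinnedVar L P (glue (box 3 L) τ .plus)) / ((box 3 L).card.choose k : ℝ)

/-- The pinning-efficiency normalisation `e = k·v/((n+1)(n−k+1))`, `n = |Λ_L|` (linear in `v`).
(Route-posited notation.) -/
def effOf (L k : ℕ) (v : ℝ) : ℝ :=
  (k : ℝ) * v / ((((box 3 L).card : ℝ) + 1) * (((box 3 L).card : ℝ) - k + 1))

/-- The planted-pinning efficiency `e_L(k)` (the crux's `eff L k`, definitionally).
(Route-posited notation.) -/
def plantedEff (L k : ℕ) : ℝ := effOf L k (plantedVar L k)

/-! ### The linear (Gaussian) benchmark built from the truncated two-point function only -/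

/-- Truncated two-point function (covariance matrix) of the critical `+` state in `Λ_L`,
`G_L(x,y) = ⟨σ_xσ_y⟩⁺_L − ⟨σ_x⟩⁺_L ⟨σ_y⟩⁺_L`. (Route-posited notation.) -/
def cov (L : ℕ) (x y : Site 3) : ℝ :=
  plusE L (fun σ => spinAt x σ * spinAt y σ) - plusE L (spinAt x) * plusE L (spinAt y)

/-- Covariance matrix of the pinned spins, `G_{PP}`. (Route-posited notation.) -/
def covMat (L : ℕ) (P : Finset (Site 3)) : Matrix ↥P ↥P ℝ :=
  Matrix.of fun a b => cov L a.1 b.1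

/-- `Cov⁺_L(M_L, σ_a) = Σ_{x ∈ Λ_L} G_L(x,a)`. (Route-posited notation.) -/
def covTot (L : ℕ) (a : Site 3) : ℝ :=
  ∑ x ∈ box 3 L, cov L x a

/-- LINEAR residual variance of `M_L` given `σ_P` (Schur complement; value-blind):
`R_L(P) = Var⁺_L(M_L) − C_{M,P} (G_{PP})⁻¹ C_{P,M}`. For a Gaussian vector with covariance `G_L`
this is the conditional variance given the pins. `Matrix.inv` is Mathlib's (zero on singular
matrices); for `P ⊆ Λ_L` the matrix `G_{PP}` is positive definite. (Route-posited notation.) -/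
def linResidual (L : ℕ) (P : Finset (Site 3)) : ℝ :=
  (∑ x ∈ box 3 L, ∑ y ∈ box 3 L, cov L x y)
    - ∑ a : ↥P, ∑ b : ↥P, covTot L a.1 * (covMat L P)⁻¹ a b * covTot L b.1

/-- Best LINEAR (affine) predictor of `M_L` from the pinned spins, evaluated at `η`:
`Lin_P(η) = ⟨M_L⟩⁺_L + C_{M,P} (G_{PP})⁻¹ (η_P − ⟨σ_P⟩⁺_L)`. (Route-posited notation.) -/
def linPred (L : ℕ) (P : Finset (Site 3)) (η : SpinConfig (Site 3)) : ℝ :=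
  plusE L (totalSpin L)
    + ∑ a : ↥P, ∑ b : ↥P,
        covTot L a.1 * (covMat L P)⁻¹ a b * (spinAt b.1 η - plusE L (spinAt b.1))

/-- NONLINEAR regression gap `N_L(P) = E⁺[(E[M_L | σ_P] − Lin_P(σ_P))²] ≥ 0`: squared `L²(μ⁺_L)`-norm
of the nonlinear part of the planted regression. (Route-posited notation.) -/
def regressionGap (L : ℕ) (P : Finset (Site 3)) : ℝ :=
  ∑ τ : ↥(box 3 L) → ℤˣ, plusProb L τ *
    (pinnedMean L P (glue (box 3 L) τ .plus) - linPred L P (glue (box 3 L) τ .plus)) ^ 2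

/-- Linear residual averaged over uniform `k`-subsets. (Route-posited notation.) -/
def linVar (L k : ℕ) : ℝ :=
  (∑ P ∈ (box 3 L).powersetCard k, linResidual L P) / ((box 3 L).card.choose k : ℝ)

/-- Regression gap averaged over uniform `k`-subsets. (Route-posited notation.) -/
def gapVar (L k : ℕ) : ℝ :=
  (∑ P ∈ (box 3 L).powersetCard k, regressionGap L P) / ((box 3 L).card.choose k : ℝ)

/-- LINEAR pinning efficiency `e^{lin}_L(k)` (pinning efficiency of the Gaussian vector with the
Ising covariance). (Route-posited notation.) -/
def linEff (L k : ℕ) : ℝ := effOf L k (linVar L k)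

/-- Regression-gap efficiency `e^{gap}_L(k) ≥ 0`; `e = e^{lin} − e^{gap}` given `VarianceSplit`.
(Route-posited notation.) -/
def gapEff (L k : ℕ) : ℝ := effOf L k (gapVar L k)

/-! ### The three currencies of the line -/

/-- STUB A statement (identity level): planted conditional variance = linear residual − regression
gap, for every `L` and every `P ⊆ Λ_L`. (Route-posited statement of the line.) -/
def VarianceSplit : Prop :=
  ∀ (L : ℕ) (P : Finset (Site 3)), P ⊆ box 3 L →
    ∑ τ : ↥(box 3 L) → ℤˣ, plusProb L τ * pinnedVar L P (glue (box 3 L) τ .plus)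
      = linResidual L P - regressionGap L P

/-- STUB B statement (two-point level, no Gaussianity): under the two-point part of the crux
hypotheses the LINEAR efficiency saturates, `liminf_{p→0⁺} liminf_L e^{lin}_L(⌈p|Λ_L|⌉) ≥ 1`.
(Route-posited statement of the line.) -/
def TwoPointSaturation : Prop :=
  ∀ (ρ : ℝ → ℝ) (Δ : ℝ) (S : CorrFamily 3), (∀ δ ∈ Set.Ioc (0:ℝ) 1, 0 < ρ δ) → 0 < Δ →
    HasPointwiseScalingLimit (criticalCorr 3) ρ S → IsNondegenerateTwoPoint S →
    IsMoebiusCovariant Δ S →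
    ∀ ε : ℝ, 0 < ε → ∃ p₀ : ℝ, 0 < p₀ ∧ ∀ p : ℝ, 0 < p → p < p₀ → ∃ L₀ : ℕ, ∀ L ≥ L₀,
      1 - ε ≤ linEff L ⌈p * ((box 3 L).card : ℝ)⌉₊

/-- STUB C statement (load-bearing): a Gaussian (`U₄ ≡ 0` off coincidences) non-degenerate
Möbius limit linearises the planted regression — the gap efficiency vanishes,
`limsup_{p→0⁺} limsup_L e^{gap}_L(⌈p|Λ_L|⌉) = 0`. (Route-posited statement of the line.) -/
def GaussianLinearisesRegression : Prop :=
  ∀ (ρ : ℝ → ℝ) (Δ : ℝ) (S : CorrFamily 3), (∀ δ ∈ Set.Ioc (0:ℝ) 1, 0 < ρ δ) → 0 < Δ →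
    HasPointwiseScalingLimit (criticalCorr 3) ρ S → IsNondegenerateTwoPoint S →
    IsMoebiusCovariant Δ S → ¬ HasNontrivialU4 S →
    ∀ ε : ℝ, 0 < ε → ∃ p₀ : ℝ, 0 < p₀ ∧ ∀ p : ℝ, 0 < p → p < p₀ → ∃ L₀ : ℕ, ∀ L ≥ L₀,
      gapEff L ⌈p * ((box 3 L).card : ℝ)⌉₊ ≤ ε

/-! ### Sanity lemmas and the composition certificate -/

/-- Given the variance split (stub A), the planted efficiency is the linear efficiency minus the
gap efficiency: sum A over the uniform `k`-subsets and push it through the linear normalisation. -/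
theorem plantedEff_eq_linEff_sub_gapEff (hA : VarianceSplit) (L k : ℕ) :
    plantedEff L k = linEff L k - gapEff L k := by
  have hnum : (∑ P ∈ (box 3 L).powersetCard k, ∑ τ : ↥(box 3 L) → ℤˣ,
        plusProb L τ * pinnedVar L P (glue (box 3 L) τ .plus))
      = (∑ P ∈ (box 3 L).powersetCard k, linResidual L P)
          - ∑ P ∈ (box 3 L).powersetCard k, regressionGap L P := by
    rw [← Finset.sum_sub_distrib]
    refine Finset.sum_congr rfl fun P hP => ?_
    exact hA L P (Finset.mem_powersetCard.1 hP).1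
  unfold plantedEff linEff gapEff effOf plantedVar linVar gapVar
  rw [hnum, sub_div]
  ring

/-- The crux, unfolded through its `let`-tower, is the saturation statement for `plantedEff`
(definitional: `Iff.rfl`). -/
theorem gaussianPinningSaturation_iff :
    GaussianPinningSaturation ↔
      ∀ (ρ : ℝ → ℝ) (Δ : ℝ) (S : CorrFamily 3), (∀ δ ∈ Set.Ioc (0:ℝ) 1, 0 < ρ δ) → 0 < Δ →
        HasPointwiseScalingLimit (criticalCorr 3) ρ S → IsNondegenerateTwoPoint S →
        IsMoebiusCovariant Δ S → ¬ HasNontrivialU4 S →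
        ∀ ε : ℝ, 0 < ε → ∃ p₀ : ℝ, 0 < p₀ ∧ ∀ p : ℝ, 0 < p → p < p₀ → ∃ L₀ : ℕ, ∀ L ≥ L₀,
          1 - ε ≤ plantedEff L ⌈p * ((box 3 L).card : ℝ)⌉₊ :=
  Iff.rfl

/-- **Composition certificate** of the line: stubs A (`VarianceSplit`), B (`TwoPointSaturation`)
and C (`GaussianLinearisesRegression`) imply the crux `GaussianPinningSaturation` by name:
`e = e^{lin} − e^{gap} ≥ (1 − ε/2) − ε/2` for `p < min p₁ p₂` and `L ≥ max L₁ L₂`. -/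
theorem gaussianPinningSaturation_of_split (hA : VarianceSplit) (hB : TwoPointSaturation)
    (hC : GaussianLinearisesRegression) : GaussianPinningSaturation := by
  rw [gaussianPinningSaturation_iff]
  intro ρ Δ S hρ hΔ hlim hnd hmob hU4 ε hε
  obtain ⟨p₁, hp₁, h₁⟩ := hB ρ Δ S hρ hΔ hlim hnd hmob (ε / 2) (by linarith)
  obtain ⟨p₂, hp₂, h₂⟩ := hC ρ Δ S hρ hΔ hlim hnd hmob hU4 (ε / 2) (by linarith)
  refine ⟨min p₁ p₂, lt_min hp₁ hp₂, fun p hp hpp => ?_⟩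
  obtain ⟨L₁, hL₁⟩ := h₁ p hp (lt_of_lt_of_le hpp (min_le_left _ _))
  obtain ⟨L₂, hL₂⟩ := h₂ p hp (lt_of_lt_of_le hpp (min_le_right _ _))
  refine ⟨max L₁ L₂, fun L hL => ?_⟩
  have hlin := hL₁ L (le_trans (le_max_left _ _) hL)
  have hgap := hL₂ L (le_trans (le_max_right _ _) hL)
  rw [plantedEff_eq_linEff_sub_gapEff hA]
  linarith

/-- Registered bookkeeping stub `stub_splitCertificate` of the crux item (lead seat c1): the
composition certificate `crux ⇐ A ∧ B ∧ C`, keyed by its registered name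
(= `gaussianPinningSaturation_of_split`). -/
theorem stub_splitCertificate :
    VarianceSplit → TwoPointSaturation → GaussianLinearisesRegression → GaussianPinningSaturation :=
  gaussianPinningSaturation_of_split

/-! ### Reshape of stub B (lead seat c1, 2026-08-17): B ⟺ B1 ∧ B2 (appended, D-0016 append-only)

Stub B `TwoPointSaturation` is split along the exact Riccati bookkeeping of the linear flow
`v_j = linVar L j`: with `k = ⌈pn⌉`, `A = k/((n+1)(n−k+1))`, one has `e^{lin} = A·v_k`, and
`e^{lin} ≥ 1/(1/(A v_0) + 1 + ε)` as soon as `1/v_k − 1/v_0 ≤ (1+ε)A`. So B follows from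
* B1 `BoxSusceptibilityFloor` — the `+` box susceptibility `v_0/n = n⁻¹ Σ_{x,y} Cov⁺_L(σ_x,σ_y)`
  diverges as `L → ∞` (at `β_c(3)`; provable now: GKS volume-monotonicity, `m*(β_c) = 0` (ADS 2015),
  the lower bound `⟨σ₀σ_x⟩_{β_c} ≥ c‖x‖⁻²` of `criticalTwoPoint_bounds_holds`, FKG positivity), which
  kills the `1/(A v_0) = (1−p)/(pχ_L)(1+o(1))` term at fixed `p`; and
* B2 `LinRiccatiSaturation` — the LOAD-BEARING kernel statement: along the whole flow `j < ⌈pn⌉` the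
  averaged Riccati slack of the random Schur complements of the critical covariance vanishes as
  `p → 0⁺` (after `L → ∞`), written multiplicatively (no inverses, no division by `v_k`):
  `v_0 ≤ v_k · (1 + (1+ε)·A·v_0)`.
`BoxCovTendsto` (thermodynamic limit of the box covariance, provable now) is recorded as the common
currency of B1/B2/C work. The glue `B ⟸ B1 ∧ B2` is `twoPointSaturation_of_floor_of_riccati` in
`Theorems/PlantedPinningGaussianPinningSaturationTwoPointReduction.lean`. -/

/-- B1 statement: the `+` box susceptibility at `β_c(3)` diverges — for every `C`, eventually
`C·|Λ_L| ≤ Σ_{x,y ∈ Λ_L} Cov⁺_{Λ_L}(σ_x, σ_y) = Var⁺_{Λ_L}(M_L)`. (Route-posited statement of the line;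
a consequence of Duminil-Copin 2019 Thm 4.8 + ADS 2015, provable now.) -/
def BoxSusceptibilityFloor : Prop :=
  ∀ C : ℝ, ∃ L₀ : ℕ, ∀ L ≥ L₀,
    C * ((box 3 L).card : ℝ) ≤ ∑ x ∈ box 3 L, ∑ y ∈ box 3 L, cov L x y

/-- B2 statement (load-bearing, kernel level): saturation of the LINEAR Riccati flow — for every
`ε > 0`, for `p` small and `L ≥ L₀(p)`, with `k = ⌈p|Λ_L|⌉` and `v_j = linVar L j`,
`v_0 ≤ v_k · (1 + (1+ε) · k·v_0/((n+1)(n−k+1)))`, i.e. `1/v_k − 1/v_0 ≤ (1+ε)·k/((n+1)(n−k+1))`: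
the averaged slack (residual single-spin variance, Cauchy–Schwarz over the new pin, Jensen over pin
sets) of the random Schur complements of the critical `+` box covariance vanishes. For Markov kernels
(lattice GFF) this is the Bernoulli-trapping / range law of large numbers; for the critical Ising
kernel it is open. (Route-posited statement of the line.) -/
def LinRiccatiSaturation : Prop :=
  ∀ ε : ℝ, 0 < ε → ∃ p₀ : ℝ, 0 < p₀ ∧ ∀ p : ℝ, 0 < p → p < p₀ → ∃ L₀ : ℕ, ∀ L ≥ L₀,
    linVar L 0 ≤ linVar L ⌈p * ((box 3 L).card : ℝ)⌉₊ *
      (1 + (1 + ε) * effOf L ⌈p * ((box 3 L).card : ℝ)⌉₊ (linVar L 0))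

/-- Common currency of B1/B2/C work: the thermodynamic limit of the truncated box two-point
function, `Cov⁺_{Λ_L}(σ_x,σ_y) → ⟨σ_xσ_y⟩⁺_{β_c} = ⟨σ₀σ_{y−x}⟩⁺_{β_c}` as `L → ∞` (`m*(β_c(3)) = 0`,
translation invariance). (Route-posited statement; provable now from `hasBoxLimit_isingCorr_plus_holds`,
`spontaneousMagnetization_criticalBeta_eq_zero_holds`, `plusCorr_shift`.) -/
def BoxCovTendsto : Prop :=
  ∀ x y : Site 3,
    Filter.Tendsto (fun L : ℕ => cov L x y) Filter.atTop (nhds (criticalTwoPoint 3 (y - x)))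

/-- `R_L(∅) = Var⁺_L(M_L)`: with no pins the linear residual is the full variance. -/
theorem linResidual_empty (L : ℕ) :
    linResidual L ∅ = ∑ x ∈ box 3 L, ∑ y ∈ box 3 L, cov L x y := by
  unfold linResidual
  simp

/-- `v_0 = Var⁺_L(M_L) = Σ_{x,y} Cov⁺_L(σ_x,σ_y)`. -/
theorem linVar_zero (L : ℕ) : linVar L 0 = ∑ x ∈ box 3 L, ∑ y ∈ box 3 L, cov L x y := by
  unfold linVar
  rw [Finset.powersetCard_zero, Finset.sum_singleton, linResidual_empty, Nat.choose_zero_right,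
    Nat.cast_one, div_one]

end Summit.CriticalPhenomena.Ising3DConformalLimit.PlantedPinningGaussianPinningSaturation

end
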